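import Summits.Schanuel.Schanuel.Theorems.RigidCoreSparsityTwoDefs
import Summits.Schanuel.Schanuel.Theorems.RigidCoreSparsityTwoSplitLemmas
import Summits.Schanuel.Schanuel.Theorems.RigidCoreSparsityTwoBakerDepthCapRay

/-!
# Every LINEAR cusp datum has a finite Baker depth cap (`linearCusp_bakerDepthCap`, lead c3)

Line `cusp-germ-schneider-sparsity` of the crux `RigidCore.SparsityTwo` (item stmt-Schanuel-0971), over the
definitions module `RigidCoreSparsityTwoDefs` (`CuspDatum`, `defectGerm`, `indepHits`) and the pocket
`stub_bakerDepthCapRay` (`RigidCoreSparsityTwoBakerDepthCapRay`, Baker 1975 Thm 3.1 PROVED in the tree).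

`linearCusp_bakerDepthCap`: for a normalised cusp datum `D` with LINEAR `t`-jet `x₂ = β x₁ + G t`
(`β` algebraic irrational, `G` analytic with algebraic Taylor data) there is `K : ℕ` — depending only on
`(D.e, β, G 0, D.ℓ₀ 0, D.ℓ₁ 0)` — such that if the defect germ `Φ = β(ℓ₀ − ℓ₀ 0) − (ℓ₁ − ℓ₁ 0) + G` is flat to
order `K` at `0` (`Φ⁽ʲ⁾(0) = 0`, `1 ≤ j ≤ K`) then `D.indepHits` is finite.  Bookkeeping = the split's
(`RigidCoreSparsityTwoSplitLinear`): the linear-jet normal form `A = β X^e + a₀` (`linearJet_normalForm`), the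
hit identity `2πi L = 2πi β n + Φ(T σₙ) + (β ℓ₀ 0 − ℓ₁ 0)` at late hits, and the ray relation
`(T σₙ)⁻ᵉ = 2πi n + ℓu σₙ`; then the pocket.

Consequence for the atoms (registered, `RigidCoreSparsityTwoDefs`): the torsion-homogeneous atom A1
(`LinearCuspAtom`) already carries the ROTH cap `ord₀ Φ ≤ e`; the inhomogeneous atom A2 (`InhomogeneousCuspAtom`)
is now capped too — for each datum only the depths `ord₀(Φ − Φ 0) ≤ K_Baker(D, β, G 0)` can carry infinitely
many hits, i.e. the open content of A2 is the exact inhomogeneous coincidence problem at BAKER-BOUNDED depth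
(`inhomogeneousCusp_depth_le_of_infinite`).  No unproved facts; axioms standard.
-/

set_option linter.dupNamespace false

namespace Summit.Schanuel.Schanuel.Cruxes.SparsityTwo.CuspGermSchneiderSparsity

open Filter Topology Complex Polynomial Literature.NumberTheory.Transcendental
open scoped Real

namespace CuspDatum

/-- The ray relation of a cusp datum along `t n := T σₙ`, `σₙ = (w n)⁻¹`: eventually `T σₙ ≠ 0` and
`(T σₙ)⁻ᵉ = 2πi n + ℓu σₙ` (from `link` and `(w n)^e = n`). -/
theorem eventually_rayRel (D : CuspDatum) :
    ∀ᶠ n : ℕ in atTop, D.T (rayAbscissa D.e n)⁻¹ ≠ 0 ∧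
      ((D.T (rayAbscissa D.e n)⁻¹) ^ D.e)⁻¹ = 2 * ↑π * I * (n : ℂ) + D.ℓu (rayAbscissa D.e n)⁻¹ := by
  simp only [rayAbscissa]
  filter_upwards [eventually_rayPoint_mem_puncturedDisc D.e_pos D.ρ_pos] with n hn
  obtain ⟨hT1, -, h3, -, -, -⟩ := D.link _ hn.1 hn.2
  refine ⟨norm_pos_iff.mp hT1, ?_⟩
  rw [h3, inv_inv, rayAbscissa_pow D.e_pos n]

/-- `t n = T σₙ → 0`. -/
theorem tendsto_T_rayPoint (D : CuspDatum) : Tendsto (fun n : ℕ => D.T (rayAbscissa D.e n)⁻¹) atTop (𝓝 0) := by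
  simp only [rayAbscissa]
  have hσlim := (tendsto_rayPoint_nhdsNE D.e_pos).mono_right nhdsWithin_le_nhds
  have h := (D.T_analytic.continuousAt.tendsto).comp hσlim
  rwa [D.T_zero] at h

/-- `ℓu σₙ → ℓu 0`. -/
theorem tendsto_ℓu_rayPoint (D : CuspDatum) :
    Tendsto (fun n : ℕ => D.ℓu (rayAbscissa D.e n)⁻¹) atTop (𝓝 (D.ℓu 0)) := by
  simp only [rayAbscissa]
  exact (D.ℓu_analytic.continuousAt.tendsto).comp ((tendsto_rayPoint_nhdsNE D.e_pos).mono_right nhdsWithin_le_nhds)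

/-- **Hit identity of a linear cusp datum.** If the `t`-jet is linear, `x₂ = β x₁ + G t`, then at every late
ray point a hit `A(w n) + g(σₙ) = L ∈ ℤ` reads `2πi L = 2πi β n + Φ(T σₙ) + (β ℓ₀ 0 − ℓ₁ 0)` with the defect
germ `Φ = D.defectGerm β G` (linear-jet normal form `A = β X^e + a₀` and the linking identities). -/
theorem linearJet_hitIdentity (D : CuspDatum) {G : ℂ → ℂ} {β : ℂ} (hG : AnalyticAt ℂ G 0)
    (hjet : D.IsLinearJet β G) :
    ∀ᶠ n : ℕ in atTop, ∀ L : ℤ, D.A.eval (rayAbscissa D.e n) + D.g (rayAbscissa D.e n)⁻¹ = L →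
      2 * ↑π * I * (L : ℂ) = 2 * ↑π * I * β * n + D.defectGerm β G (D.T (rayAbscissa D.e n)⁻¹) +
        (β * D.ℓ₀ 0 - D.ℓ₁ 0) := by
  simp only [rayAbscissa]
  have hw_pow : ∀ N : ℕ, ((((N : ℝ) ^ ((D.e : ℝ)⁻¹) : ℝ) : ℂ)) ^ D.e = (N : ℂ) := fun N => rayAbscissa_pow D.e_pos N
  have hσmem := eventually_rayPoint_mem_puncturedDisc D.e_pos D.ρ_pos
  -- the σ-side jet identity and the normal form `A = β X^e + a₀`
  have hjetσ : ∀ σ : ℂ, 0 < ‖σ‖ → ‖σ‖ < D.ρ →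
      2 * ↑π * I * (D.A.eval σ⁻¹ + D.g σ) + D.ℓv σ = β * (2 * ↑π * I * σ⁻¹ ^ D.e + D.ℓu σ) + G (D.T σ) := by
    intro σ hσ1 hσ2
    obtain ⟨hT1, hT2, h3, h4, -, -⟩ := D.link σ hσ1 hσ2
    rw [← h4, ← h3]
    exact hjet _ hT1 hT2
  obtain ⟨a₀, hAeq⟩ := linearJet_normalForm D.ρ_pos D.g_analytic D.ℓu_analytic D.ℓv_analytic D.T_analytic
    D.T_zero hG D.link hjet
  have hAeval : ∀ z : ℂ, D.A.eval z = β * z ^ D.e + a₀ := by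
    intro z
    rw [hAeq, Polynomial.eval_add, Polynomial.eval_mul, Polynomial.eval_C, Polynomial.eval_pow,
      Polynomial.eval_X, Polynomial.eval_C]
  have hgΦ : ∀ σ : ℂ, 0 < ‖σ‖ → ‖σ‖ < D.ρ →
      2 * ↑π * I * D.g σ = D.defectGerm β G (D.T σ) + (β * D.ℓ₀ 0 - D.ℓ₁ 0 - 2 * ↑π * I * a₀) := by
    intro σ hσ1 hσ2
    obtain ⟨-, -, -, -, h5, h6⟩ := D.link σ hσ1 hσ2
    have hj := hjetσ σ hσ1 hσ2
    rw [hAeval] at hj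
    simp only [CuspDatum.defectGerm, h5, h6]
    linear_combination hj
  filter_upwards [hσmem] with N hN L hL
  have hj := hgΦ _ hN.1 hN.2
  rw [hAeval, hw_pow] at hL
  linear_combination (-(2 * ↑π * I)) * hL + hj

end CuspDatum

/-- **Every linear cusp datum has a finite Baker depth cap.**  For a normalised cusp datum `D` with linear
`t`-jet of algebraic irrational slope `β` and regular part `G` (analytic, algebraic Taylor data) there is
`K : ℕ`, depending only on `(D.e, β, G 0, D.ℓ₀ 0, D.ℓ₁ 0)`, such that: if the defect germ `D.defectGerm β G` is flat
to order `K` at `0`, the independent hits are finite.  (The pocket `stub_bakerDepthCapRay` — Baker 1975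
Thm 3.1, tree theorem `baker1975_thm_3_1_holds` — along `t n = T σₙ`, fed with the hit identity.) -/
theorem linearCusp_bakerDepthCap :
    ∀ (D : CuspDatum) (G : ℂ → ℂ) (β : ℂ), AnalyticAt ℂ G 0 → D.IsLinearJet β G → IsAlgebraic ℚ β →
      (∀ n : ℕ, IsAlgebraic ℚ (iteratedDeriv n G 0)) → (∀ r' : ℚ, (r' : ℂ) ≠ β) →
      ∃ K : ℕ, ((∀ j : ℕ, 1 ≤ j → j ≤ K → iteratedDeriv j (D.defectGerm β G) 0 = 0) → D.indepHits.Finite) := by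
  intro D G β hG hjet hβalg hGalg hβirr
  have hG0alg : IsAlgebraic ℚ (G 0) := by simpa using hGalg 0
  obtain ⟨K, hK⟩ := stub_bakerDepthCapRay D.e β (G 0) (D.ℓ₀ 0) (D.ℓ₁ 0) D.e_pos hβalg hβirr hG0alg
    D.exp_ℓ₀_algebraic D.exp_ℓ₁_algebraic
  refine ⟨K, fun hflat => ?_⟩
  have hΦan : AnalyticAt ℂ (D.defectGerm β G) 0 :=
    ((analyticAt_const.mul (D.ℓ₀_analytic.sub analyticAt_const)).sub
      (D.ℓ₁_analytic.sub analyticAt_const)).add hG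
  have hΦ0 : D.defectGerm β G 0 = G 0 := by simp [CuspDatum.defectGerm]
  have hfin := hK (D.defectGerm β G) (fun n => D.T (rayAbscissa D.e n)⁻¹) (fun n => D.ℓu (rayAbscissa D.e n)⁻¹)
    (D.ℓu 0) hΦan hΦ0 hflat D.tendsto_T_rayPoint D.tendsto_ℓu_rayPoint D.eventually_rayRel
  have hhit := D.linearJet_hitIdentity hG hjet
  rw [← Nat.cofinite_eq_atTop, Filter.eventually_cofinite] at hhit
  refine (hhit.union hfin).subset ?_
  rintro n ⟨-, L, hL⟩
  by_cases hP : ∀ L : ℤ, D.A.eval (rayAbscissa D.e n) + D.g (rayAbscissa D.e n)⁻¹ = L →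
      2 * ↑π * I * (L : ℂ) = 2 * ↑π * I * β * n + D.defectGerm β G (D.T (rayAbscissa D.e n)⁻¹) +
        (β * D.ℓ₀ 0 - D.ℓ₁ 0)
  · exact Or.inr ⟨L, hP L hL⟩
  · exact Or.inl hP

/-- **The inhomogeneous atom at unbounded depth is settled** (corollary, contrapositive form for A2's data):
if a linear cusp datum carries INFINITELY many independent hits, its defect germ is not flat beyond the Baker
cap — some derivative of order `1 ≤ j ≤ K_Baker` of `Φ` at `0` is non-zero.  So the open content of
`InhomogeneousCuspAtom` is the exact-coincidence problem at depth `≤ K_Baker(D, β, G 0)`. -/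
theorem inhomogeneousCusp_depth_le_of_infinite :
    ∀ (D : CuspDatum) (G : ℂ → ℂ) (β : ℂ), AnalyticAt ℂ G 0 → D.IsLinearJet β G → IsAlgebraic ℚ β →
      (∀ n : ℕ, IsAlgebraic ℚ (iteratedDeriv n G 0)) → (∀ r' : ℚ, (r' : ℂ) ≠ β) →
      ∃ K : ℕ, (D.indepHits.Infinite →
        ∃ j : ℕ, 1 ≤ j ∧ j ≤ K ∧ iteratedDeriv j (D.defectGerm β G) 0 ≠ 0) := by
  intro D G β hG hjet hβalg hGalg hβirr
  obtain ⟨K, hK⟩ := linearCusp_bakerDepthCap D G β hG hjet hβalg hGalg hβirr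
  refine ⟨K, fun hinf => ?_⟩
  by_contra h
  push Not at h
  exact hinf (hK fun j hj1 hjK => h j hj1 hjK)

end Summit.Schanuel.Schanuel.Cruxes.SparsityTwo.CuspGermSchneiderSparsity
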